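import Summits.QuantumFields.YangMills.Theorems.BalabanLadderNTCeilingPriceThreePoint
import Summits.QuantumFields.YangMills.Theorems.BalabanLadderNTCeilingPriceWindow
import HarnessLib

/-!
# Crux `NT` (stmt-QuantumFields-19353), stub `stub_refpkgT : RefPkgT`: the one-point ceiling prices the floors, VI — the
# THREE-point window prices `C₃` and `C₁C₂`: `C₃ ≤ 2¹¹·4¹² C₁³ κ⁴ σ⁸ / δ'¹²`, `C₁C₂ ≤ (64/3)·4¹² C₁³ κ⁸ σ⁴ / δ'¹²`

Helper file (`--supports stmt-QuantumFields-19353`) of the fleet lead prover of crux `NT` (unit `ym-spine-19353-p1`, GEN 13);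
the clause-5 twin of GEN 12's `…NTCeilingPriceWindow` (`C₂ ≤ 64C₁²σ⁴κ⁴/δ⁸` from clause 4).  Hypothesis-free, general compact
`G`, any `r`, any unit map `a > 0` with `a → 0`.

On one reference torus the registered clause-5 inequality and the clause-1 cap (`…NTCeilingPriceSmeared.abs_Q3_le_of_e1osc`)
read `ε + ΣΣΣ|f||g||h|·m(x,y,z) ≤ |Q3(f,g,h)| ≤ S_fS_gS_h(2C₁/R⁴)³`, `R ≈ δ'/(4s)`.  The three witnesses live in the ball of
radius `σ`, so every charged triple has all pairwise lattice separations `≤ 2σ/s`; hence the per-triple margin `m` is at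
least `m_low := 2(3k·k₂/(1+2σ/s)⁴ + k³) + k₃/(1+2σ/s)⁸` (`k = C₁t`, `k₂ = C₂t`, `k₃ = C₃t`, `t = (s/κ)⁴`) and, with the SAME
`S_fS_gS_h` on both sides, every envelope cancels:

* `margin₃_ge` — the registered clause-5 margin is at least `S_fS_gS_h · m_low`;
* **`C₃_lt_of_clause5_at`** — at one coupling, on a collar-large reference torus (`2σ ≤ sL`, `δ' ≤ sL`, `3s < δ'/4`, `δ' ≤ 2ℓ`):
  **`C₃ < 8C₁³κ⁴(s+2σ)⁸/(δ'/4 − 3s)¹²`**; **`C₃_le_of_clause5`** — β-uniformly **`C₃ ≤ 8C₁³κ⁴(2σ)⁸/(δ'/4)¹²`**;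
* **`C₁C₂_lt_of_clause5_at`** — **`C₁C₂ < (4/3)C₁³κ⁸(s+2σ)⁴/(δ'/4 − 3s)¹²`**; **`C₁C₂_le_of_clause5`** — β-uniformly
  **`C₁C₂ ≤ (4/3)C₁³κ⁸(2σ)⁴/(δ'/4)¹²`** (for `C₁ > 0`: `C₂ ≤ (4/3)C₁²κ⁸(2σ)⁴/(δ'/4)¹²`, `C₂_le_of_clause5`).

Together with GEN 12 (memo SIZING-19353-g13 §2): every instance of the registered stub has its two- and three-point
oscillation constants capped by powers of its one-point constant times witness geometry — the E2/E3 ceilings a package may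
USE in its margins are never larger than what clause 1 already lets the torus cumulants be.

HONEST FRAMING.  Real arithmetic and limits over the sequels; CONDITIONAL on clause 1; no floor, not AF, not NT, not the seam,
not the gap; not Clay.
-/

set_option autoImplicit false

noncomputable section

open scoped SchwartzMap
open MeasureTheory Filter Topology
open Literature.MathematicalPhysics.QuantumFieldTheory Literature.MathematicalPhysics.QuantumLattice
open Literature.Probability.LatticeModels
open Summit.QuantumFields.YangMills.Cruxes.OSLegsFromFemtoAndGap.DlrCollarTransfer
open Summit.QuantumFields.YangMills.Theorems.OSLegsFromFemtoAndGap (siteToE_sub)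
open Summit.QuantumFields.YangMills.Cruxes.NT.Reference (norm_siteToE_le_of_apply_ne_zero)

namespace Summit.QuantumFields.YangMills.Cruxes.NT.CeilingPrice

/-! ## §1 The registered clause-5 margin from below on charged triples -/

section Margin

/-- Charged points of a witness in the ball of radius `σ` are pairwise at lattice distance `≤ 2σ/s`. [folklore] -/
theorem norm_siteToE_sub_le_of_apply_ne_zero {f g : 𝓢(EuclideanSpace ℝ (Fin 4), ℝ)} {σ s : ℝ} (hs : 0 < s)
    (hfσ : tsupport (f : EuclideanSpace ℝ (Fin 4) → ℝ) ⊆ Metric.closedBall 0 σ)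
    (hgσ : tsupport (g : EuclideanSpace ℝ (Fin 4) → ℝ) ⊆ Metric.closedBall 0 σ) {x y : Fin 4 → ℤ}
    (hx : f (s • siteToE x) ≠ 0) (hy : g (s • siteToE y) ≠ 0) : ‖siteToE (y - x)‖ ≤ 2 * σ / s := by
  have hX := norm_siteToE_le_of_apply_ne_zero hs hfσ hx
  have hY := norm_siteToE_le_of_apply_ne_zero hs hgσ hy
  rw [siteToE_sub]
  calc ‖siteToE y - siteToE x‖ ≤ ‖siteToE y‖ + ‖siteToE x‖ := norm_sub_le _ _
    _ ≤ σ / s + σ / s := add_le_add hY hX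
    _ = 2 * σ / s := by ring

/-- Per-triple comparison: on a charged triple (all pairwise separations `≤ M`) the registered clause-5 margin dominates
`2(3k k₂/(1+M)⁴ + k³) + k₃/(1+M)⁸`. [folklore] -/
theorem perTriple_margin_ge {k k₂ k₃ M d₁ d₂ d₃ m : ℝ} (hk : 0 ≤ k) (hk₂ : 0 ≤ k₂) (hk₃ : 0 ≤ k₃)
    (hd₁ : 0 ≤ d₁) (hd₂ : 0 ≤ d₂) (hd₃ : 0 ≤ d₃) (hm : 0 ≤ m) (h₁ : d₁ ≤ M) (h₂ : d₂ ≤ M) (h₃ : d₃ ≤ M) (hmM : m ≤ M) :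
    2 * (3 * (k * (k₂ / (1 + M) ^ 4)) + k * k * k) + k₃ / (1 + M) ^ 8 ≤
      2 * (k * (k₂ / (1 + d₁) ^ 4) + k * (k₂ / (1 + d₂) ^ 4) + k * (k₂ / (1 + d₃) ^ 4) + k * k * k) +
        k₃ / (1 + m) ^ 8 := by
  have hq : ∀ {d : ℝ}, 0 ≤ d → d ≤ M → k * (k₂ / (1 + M) ^ 4) ≤ k * (k₂ / (1 + d) ^ 4) := fun {d} hd hdM =>
    mul_le_mul_of_nonneg_left
      (div_le_div_of_nonneg_left hk₂ (by positivity) (pow_le_pow_left₀ (by linarith) (by linarith) 4)) hk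
  have h8 : k₃ / (1 + M) ^ 8 ≤ k₃ / (1 + m) ^ 8 :=
    div_le_div_of_nonneg_left hk₃ (by positivity) (pow_le_pow_left₀ (by linarith) (by linarith) 8)
  linarith [hq hd₁ h₁, hq hd₂ h₂, hq hd₃ h₃]

/-- **The registered clause-5 margin from below.**  For witnesses `f, g, h` supported in the ball of radius `σ` (spacing
`s > 0`) and `C₁, C₂, C₃ ≥ 0`, `t ≥ 0`:
`S_fS_gS_h · (2(3(C₁t)(C₂t)/(1+2σ/s)⁴ + (C₁t)³) + C₃t/(1+2σ/s)⁸) ≤ ΣΣΣ|f||g||h|·m(x,y,z)` (the registered per-triple margin `m`).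
[folklore] -/
theorem margin₃_ge {f g h : 𝓢(EuclideanSpace ℝ (Fin 4), ℝ)} {σ s : ℝ} (hs : 0 < s)
    (hfσ : tsupport (f : EuclideanSpace ℝ (Fin 4) → ℝ) ⊆ Metric.closedBall 0 σ)
    (hgσ : tsupport (g : EuclideanSpace ℝ (Fin 4) → ℝ) ⊆ Metric.closedBall 0 σ)
    (hhσ : tsupport (h : EuclideanSpace ℝ (Fin 4) → ℝ) ⊆ Metric.closedBall 0 σ) {C₁ C₂ C₃ t : ℝ} (hC₁ : 0 ≤ C₁)
    (hC₂ : 0 ≤ C₂) (hC₃ : 0 ≤ C₃) (ht : 0 ≤ t) (Λ : Finset (Fin 4 → ℤ)) :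
    (∑ x ∈ Λ, |f (s • siteToE x)|) * (∑ y ∈ Λ, |g (s • siteToE y)|) * (∑ z ∈ Λ, |h (s • siteToE z)|) *
        (2 * (3 * ((C₁ * t) * (C₂ * t / (1 + 2 * σ / s) ^ 4)) + (C₁ * t) * (C₁ * t) * (C₁ * t)) +
          C₃ * t / (1 + 2 * σ / s) ^ 8) ≤
      ∑ x ∈ Λ, ∑ y ∈ Λ, ∑ z ∈ Λ, |f (s • siteToE x)| * |g (s • siteToE y)| * |h (s • siteToE z)| *
        (2 * ((C₁ * t) * (C₂ * t / (1 + ‖siteToE (z - y)‖) ^ 4) + (C₁ * t) * (C₂ * t / (1 + ‖siteToE (z - x)‖) ^ 4) +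
              (C₁ * t) * (C₂ * t / (1 + ‖siteToE (y - x)‖) ^ 4) + (C₁ * t) * (C₁ * t) * (C₁ * t)) +
          C₃ * t / (1 + min (min ‖siteToE (y - x)‖ ‖siteToE (z - y)‖) ‖siteToE (z - x)‖) ^ 8) := by
  rw [Finset.sum_mul_sum, Finset.sum_mul, Finset.sum_mul]
  refine Finset.sum_le_sum fun x _ => ?_
  rw [Finset.sum_mul, Finset.sum_mul]
  refine Finset.sum_le_sum fun y _ => ?_
  rw [Finset.mul_sum, Finset.sum_mul]
  refine Finset.sum_le_sum fun z _ => ?_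
  by_cases hx : f (s • siteToE x) = 0
  · simp [hx]
  by_cases hy : g (s • siteToE y) = 0
  · simp [hy]
  by_cases hz : h (s • siteToE z) = 0
  · simp [hz]
  have hFGH : 0 ≤ |f (s • siteToE x)| * |g (s • siteToE y)| * |h (s • siteToE z)| := by positivity
  refine mul_le_mul_of_nonneg_left ?_ hFGH
  have hyx := norm_siteToE_sub_le_of_apply_ne_zero hs hfσ hgσ hx hy
  have hzy := norm_siteToE_sub_le_of_apply_ne_zero hs hgσ hhσ hy hz
  have hzx := norm_siteToE_sub_le_of_apply_ne_zero hs hfσ hhσ hx hz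
  have hmin : min (min ‖siteToE (y - x)‖ ‖siteToE (z - y)‖) ‖siteToE (z - x)‖ ≤ 2 * σ / s :=
    ((min_le_left _ _).trans (min_le_left _ _)).trans hyx
  exact perTriple_margin_ge (mul_nonneg hC₁ ht) (mul_nonneg hC₂ ht) (mul_nonneg hC₃ ht) (norm_nonneg _)
    (norm_nonneg _) (norm_nonneg _) (le_min (le_min (norm_nonneg _) (norm_nonneg _)) (norm_nonneg _)) hzy hzx hyx hmin

end Margin

/-! ## §2 The window prices `C₃` and `C₁C₂` -/

section Package

variable (G : Type) [Group G] [TopologicalSpace G] [IsTopologicalGroup G] [CompactSpace G]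
  [MeasurableSpace G] [BorelSpace G] (r : LatticeRep G)

/-- **The three-point window at one coupling.**  At coupling `β`, spacing `0 < s` with `3s < δ'/4`: clause 1 (E1-osc,
`C₁ ≥ 0`, range `ℓ` with `δ' ≤ 2ℓ`) and the registered clause-5 floor-with-margin for witnesses `f, g, h` (pairwise support
separation `δ'`, supports in the ball of radius `σ`, `ε > 0`, `κ > 0`, `C₂, C₃ ≥ 0`) on a collar-large reference torus
(`2σ ≤ sL`, `δ' ≤ sL`) force, with `Σ := (1+2σ/s)`,
`2(3(C₁t)(C₂t)/Σ⁴ + (C₁t)³) + C₃t/Σ⁸ < (2C₁/R⁴)³` for the collar radius `R = ⌊δ'/4/s⌋₊ − 2` (`t = (s/κ)⁴`), where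
`δ'/4 − 3s ≤ sR`. [folklore] -/
theorem window₃_of_clause5_at (β : ℝ) {C₁ C₂ C₃ ℓ s κ : ℝ} (hC₁ : 0 ≤ C₁) (hC₂ : 0 ≤ C₂) (hC₃ : 0 ≤ C₃)
    (hs : 0 < s)
    (hE1 : ∀ (c : Fin 4 → ℤ) (b : ℕ), (b : ℝ) * s ≤ ℓ → ∀ (η η' : LGConfig 4 G) (x : Fin 4 → ℤ),
      1 ≤ depth c b x → |kerE G r β c b η (dens G r x) - kerE G r β c b η' (dens G r x)| ≤ C₁ / (depth c b x : ℝ) ^ 4)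
    {f g h : 𝓢(EuclideanSpace ℝ (Fin 4), ℝ)} {δ' σ ε : ℝ} (hε : 0 < ε) (h3 : 3 * s < δ' / 4) (hδ'ℓ : δ' ≤ 2 * ℓ)
    (hfg : ∀ p q : EuclideanSpace ℝ (Fin 4), f p ≠ 0 → g q ≠ 0 → δ' ≤ ‖p - q‖)
    (hgh : ∀ p q : EuclideanSpace ℝ (Fin 4), g p ≠ 0 → h q ≠ 0 → δ' ≤ ‖p - q‖)
    (hfh : ∀ p q : EuclideanSpace ℝ (Fin 4), f p ≠ 0 → h q ≠ 0 → δ' ≤ ‖p - q‖)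
    (hfσ : tsupport (f : EuclideanSpace ℝ (Fin 4) → ℝ) ⊆ Metric.closedBall 0 σ)
    (hgσ : tsupport (g : EuclideanSpace ℝ (Fin 4) → ℝ) ⊆ Metric.closedBall 0 σ)
    (hhσ : tsupport (h : EuclideanSpace ℝ (Fin 4) → ℝ) ⊆ Metric.closedBall 0 σ) {L : ℕ} (hσL : 2 * σ ≤ s * L)
    (hδL : δ' ≤ s * L)
    (hfloor : ε + ∑ x ∈ box 4 L, ∑ y ∈ box 4 L, ∑ z ∈ box 4 L,
        |f (s • siteToE x)| * |g (s • siteToE y)| * |h (s • siteToE z)| *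
          (2 * ((C₁ * (s / κ) ^ 4) * (C₂ * (s / κ) ^ 4 / (1 + ‖siteToE (z - y)‖) ^ 4) +
                (C₁ * (s / κ) ^ 4) * (C₂ * (s / κ) ^ 4 / (1 + ‖siteToE (z - x)‖) ^ 4) +
                (C₁ * (s / κ) ^ 4) * (C₂ * (s / κ) ^ 4 / (1 + ‖siteToE (y - x)‖) ^ 4) +
                (C₁ * (s / κ) ^ 4) * (C₁ * (s / κ) ^ 4) * (C₁ * (s / κ) ^ 4)) +
            C₃ * (s / κ) ^ 4 / (1 + min (min ‖siteToE (y - x)‖ ‖siteToE (z - y)‖) ‖siteToE (z - x)‖) ^ 8) ≤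
      |Q3 G r β L s f g h|) :
    2 * (3 * ((C₁ * (s / κ) ^ 4) * (C₂ * (s / κ) ^ 4 / (1 + 2 * σ / s) ^ 4)) +
          (C₁ * (s / κ) ^ 4) * (C₁ * (s / κ) ^ 4) * (C₁ * (s / κ) ^ 4)) +
        C₃ * (s / κ) ^ 4 / (1 + 2 * σ / s) ^ 8 <
      (2 * C₁ / ((⌊δ' / 4 / s⌋₊ - 2 : ℕ) : ℝ) ^ 4) ^ 3 := by
  obtain ⟨hR1, hR2, hR3, hR8, -⟩ := collarRadius₃_spec hs h3
  set R : ℕ := ⌊δ' / 4 / s⌋₊ - 2 with hR_def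
  have hRℓ : ((2 * R + 3 : ℕ) : ℝ) * s ≤ ℓ := hR3.trans (by linarith)
  have hRL : 4 * R + 8 ≤ L := by
    have h2 : (4 * (R : ℝ) + 8) * s ≤ s * L := hR8.trans hδL
    have h3' : (4 * (R : ℝ) + 8) ≤ L := by
      rw [mul_comm] at h2; exact le_of_mul_le_mul_left h2 hs
    exact_mod_cast h3'
  have hcap := abs_Q3_le_of_e1osc G r β hC₁ hs hE1 hfg hgh hfh hfσ hgσ hhσ hσL hR1 hRℓ hRL hR2
  have ht : 0 ≤ (s / κ) ^ 4 := by positivity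
  have hlow := margin₃_ge hs hfσ hgσ hhσ hC₁ hC₂ hC₃ ht (box 4 L)
  set P := (∑ x ∈ box 4 L, |f (s • siteToE x)|) * (∑ y ∈ box 4 L, |g (s • siteToE y)|) *
    (∑ z ∈ box 4 L, |h (s • siteToE z)|) with hP
  have hP0 : 0 ≤ P := mul_nonneg (mul_nonneg (Finset.sum_nonneg fun _ _ => abs_nonneg _)
    (Finset.sum_nonneg fun _ _ => abs_nonneg _)) (Finset.sum_nonneg fun _ _ => abs_nonneg _)
  set mlow := 2 * (3 * ((C₁ * (s / κ) ^ 4) * (C₂ * (s / κ) ^ 4 / (1 + 2 * σ / s) ^ 4)) +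
      (C₁ * (s / κ) ^ 4) * (C₁ * (s / κ) ^ 4) * (C₁ * (s / κ) ^ 4)) + C₃ * (s / κ) ^ 4 / (1 + 2 * σ / s) ^ 8 with hmlow
  -- `ε + P·mlow ≤ P·cap`, `ε > 0` ⇒ `P > 0` and `mlow < cap`
  have hwin : P * mlow < P * (2 * C₁ / (R : ℝ) ^ 4) ^ 3 := by linarith
  have hPpos : 0 < P := by
    rcases hP0.lt_or_eq with hp | hp
    · exact hp
    · exfalso; rw [← hp] at hwin; simp at hwin
  exact lt_of_mul_lt_mul_left hwin hPpos.le

/-- **`C₃` is priced at one coupling: `C₃ < 8C₁³κ⁴(s+2σ)⁸/(δ'/4 − 3s)¹²`** (hypotheses of `window₃_of_clause5_at`, `κ > 0`,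
`σ ≥ 0`). [folklore] -/
theorem C₃_lt_of_clause5_at (β : ℝ) {C₁ C₂ C₃ ℓ s κ : ℝ} (hC₁ : 0 ≤ C₁) (hC₂ : 0 ≤ C₂) (hC₃ : 0 ≤ C₃) (hκ : 0 < κ)
    (hs : 0 < s)
    (hE1 : ∀ (c : Fin 4 → ℤ) (b : ℕ), (b : ℝ) * s ≤ ℓ → ∀ (η η' : LGConfig 4 G) (x : Fin 4 → ℤ),
      1 ≤ depth c b x → |kerE G r β c b η (dens G r x) - kerE G r β c b η' (dens G r x)| ≤ C₁ / (depth c b x : ℝ) ^ 4)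
    {f g h : 𝓢(EuclideanSpace ℝ (Fin 4), ℝ)} {δ' σ ε : ℝ} (hε : 0 < ε) (hσ : 0 ≤ σ) (h3 : 3 * s < δ' / 4)
    (hδ'ℓ : δ' ≤ 2 * ℓ)
    (hfg : ∀ p q : EuclideanSpace ℝ (Fin 4), f p ≠ 0 → g q ≠ 0 → δ' ≤ ‖p - q‖)
    (hgh : ∀ p q : EuclideanSpace ℝ (Fin 4), g p ≠ 0 → h q ≠ 0 → δ' ≤ ‖p - q‖)
    (hfh : ∀ p q : EuclideanSpace ℝ (Fin 4), f p ≠ 0 → h q ≠ 0 → δ' ≤ ‖p - q‖)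
    (hfσ : tsupport (f : EuclideanSpace ℝ (Fin 4) → ℝ) ⊆ Metric.closedBall 0 σ)
    (hgσ : tsupport (g : EuclideanSpace ℝ (Fin 4) → ℝ) ⊆ Metric.closedBall 0 σ)
    (hhσ : tsupport (h : EuclideanSpace ℝ (Fin 4) → ℝ) ⊆ Metric.closedBall 0 σ) {L : ℕ} (hσL : 2 * σ ≤ s * L)
    (hδL : δ' ≤ s * L)
    (hfloor : ε + ∑ x ∈ box 4 L, ∑ y ∈ box 4 L, ∑ z ∈ box 4 L,
        |f (s • siteToE x)| * |g (s • siteToE y)| * |h (s • siteToE z)| *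
          (2 * ((C₁ * (s / κ) ^ 4) * (C₂ * (s / κ) ^ 4 / (1 + ‖siteToE (z - y)‖) ^ 4) +
                (C₁ * (s / κ) ^ 4) * (C₂ * (s / κ) ^ 4 / (1 + ‖siteToE (z - x)‖) ^ 4) +
                (C₁ * (s / κ) ^ 4) * (C₂ * (s / κ) ^ 4 / (1 + ‖siteToE (y - x)‖) ^ 4) +
                (C₁ * (s / κ) ^ 4) * (C₁ * (s / κ) ^ 4) * (C₁ * (s / κ) ^ 4)) +
            C₃ * (s / κ) ^ 4 / (1 + min (min ‖siteToE (y - x)‖ ‖siteToE (z - y)‖) ‖siteToE (z - x)‖) ^ 8) ≤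
      |Q3 G r β L s f g h|) :
    C₃ < 8 * C₁ ^ 3 * κ ^ 4 * (s + 2 * σ) ^ 8 / (δ' / 4 - 3 * s) ^ 12 := by
  have hwin := window₃_of_clause5_at G r β hC₁ hC₂ hC₃ hs hE1 hε h3 hδ'ℓ hfg hgh hfh hfσ hgσ hhσ hσL hδL hfloor
  obtain ⟨hR1, -, -, -, hR4⟩ := collarRadius₃_spec hs h3
  set R : ℕ := ⌊δ' / 4 / s⌋₊ - 2 with hR_def
  have hRpos : (0 : ℝ) < R := by exact_mod_cast hR1
  set t : ℝ := (s / κ) ^ 4 with ht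
  have ht0 : 0 < t := by positivity
  set D : ℝ := (1 + 2 * σ / s) with hD
  have hD0 : 0 < D := by positivity
  have hkk : 0 ≤ 2 * (3 * ((C₁ * t) * (C₂ * t / D ^ 4)) + (C₁ * t) * (C₁ * t) * (C₁ * t)) := by positivity
  -- drop the non-negative `C₁C₂` and `k³` parts
  have hkey : C₃ * t / D ^ 8 < 8 * C₁ ^ 3 / (R : ℝ) ^ 12 := by
    have e : (2 * C₁ / (R : ℝ) ^ 4) ^ 3 = 8 * C₁ ^ 3 / (R : ℝ) ^ 12 := by
      rw [div_pow]; ring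
    rw [← e]
    linarith
  have h1 : C₃ < 8 * C₁ ^ 3 / (R : ℝ) ^ 12 * D ^ 8 / t := by
    rw [lt_div_iff₀ ht0]
    exact (div_lt_iff₀ (pow_pos hD0 8)).1 hkey
  have e3 : 8 * C₁ ^ 3 / (R : ℝ) ^ 12 * D ^ 8 / t = 8 * C₁ ^ 3 * κ ^ 4 * (s + 2 * σ) ^ 8 / (s * R) ^ 12 := by
    rw [hD, ht]
    field_simp
  rw [e3] at h1
  have hKK : 0 ≤ 8 * C₁ ^ 3 * κ ^ 4 * (s + 2 * σ) ^ 8 := by positivity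
  exact h1.trans_le (div_le_div_of_nonneg_left hKK (pow_pos (by linarith) 12) (pow_le_pow_left₀ (by linarith) hR4 12))

/-- **`C₁C₂` is priced at one coupling: `C₁C₂ < (4/3)C₁³κ⁸(s+2σ)⁴/(δ'/4 − 3s)¹²`** (same hypotheses). [folklore] -/
theorem C₁C₂_lt_of_clause5_at (β : ℝ) {C₁ C₂ C₃ ℓ s κ : ℝ} (hC₁ : 0 ≤ C₁) (hC₂ : 0 ≤ C₂) (hC₃ : 0 ≤ C₃) (hκ : 0 < κ)
    (hs : 0 < s)
    (hE1 : ∀ (c : Fin 4 → ℤ) (b : ℕ), (b : ℝ) * s ≤ ℓ → ∀ (η η' : LGConfig 4 G) (x : Fin 4 → ℤ),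
      1 ≤ depth c b x → |kerE G r β c b η (dens G r x) - kerE G r β c b η' (dens G r x)| ≤ C₁ / (depth c b x : ℝ) ^ 4)
    {f g h : 𝓢(EuclideanSpace ℝ (Fin 4), ℝ)} {δ' σ ε : ℝ} (hε : 0 < ε) (hσ : 0 ≤ σ) (h3 : 3 * s < δ' / 4)
    (hδ'ℓ : δ' ≤ 2 * ℓ)
    (hfg : ∀ p q : EuclideanSpace ℝ (Fin 4), f p ≠ 0 → g q ≠ 0 → δ' ≤ ‖p - q‖)
    (hgh : ∀ p q : EuclideanSpace ℝ (Fin 4), g p ≠ 0 → h q ≠ 0 → δ' ≤ ‖p - q‖)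
    (hfh : ∀ p q : EuclideanSpace ℝ (Fin 4), f p ≠ 0 → h q ≠ 0 → δ' ≤ ‖p - q‖)
    (hfσ : tsupport (f : EuclideanSpace ℝ (Fin 4) → ℝ) ⊆ Metric.closedBall 0 σ)
    (hgσ : tsupport (g : EuclideanSpace ℝ (Fin 4) → ℝ) ⊆ Metric.closedBall 0 σ)
    (hhσ : tsupport (h : EuclideanSpace ℝ (Fin 4) → ℝ) ⊆ Metric.closedBall 0 σ) {L : ℕ} (hσL : 2 * σ ≤ s * L)
    (hδL : δ' ≤ s * L)
    (hfloor : ε + ∑ x ∈ box 4 L, ∑ y ∈ box 4 L, ∑ z ∈ box 4 L,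
        |f (s • siteToE x)| * |g (s • siteToE y)| * |h (s • siteToE z)| *
          (2 * ((C₁ * (s / κ) ^ 4) * (C₂ * (s / κ) ^ 4 / (1 + ‖siteToE (z - y)‖) ^ 4) +
                (C₁ * (s / κ) ^ 4) * (C₂ * (s / κ) ^ 4 / (1 + ‖siteToE (z - x)‖) ^ 4) +
                (C₁ * (s / κ) ^ 4) * (C₂ * (s / κ) ^ 4 / (1 + ‖siteToE (y - x)‖) ^ 4) +
                (C₁ * (s / κ) ^ 4) * (C₁ * (s / κ) ^ 4) * (C₁ * (s / κ) ^ 4)) +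
            C₃ * (s / κ) ^ 4 / (1 + min (min ‖siteToE (y - x)‖ ‖siteToE (z - y)‖) ‖siteToE (z - x)‖) ^ 8) ≤
      |Q3 G r β L s f g h|) :
    C₁ * C₂ < 4 / 3 * C₁ ^ 3 * κ ^ 8 * (s + 2 * σ) ^ 4 / (δ' / 4 - 3 * s) ^ 12 := by
  have hwin := window₃_of_clause5_at G r β hC₁ hC₂ hC₃ hs hE1 hε h3 hδ'ℓ hfg hgh hfh hfσ hgσ hhσ hσL hδL hfloor
  obtain ⟨hR1, -, -, -, hR4⟩ := collarRadius₃_spec hs h3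
  set R : ℕ := ⌊δ' / 4 / s⌋₊ - 2 with hR_def
  have hRpos : (0 : ℝ) < R := by exact_mod_cast hR1
  set t : ℝ := (s / κ) ^ 4 with ht
  have ht0 : 0 < t := by positivity
  set D : ℝ := (1 + 2 * σ / s) with hD
  have hD0 : 0 < D := by positivity
  have hk3 : 0 ≤ 2 * ((C₁ * t) * (C₁ * t) * (C₁ * t)) + C₃ * t / D ^ 8 := by positivity
  -- drop the non-negative `k³` and `C₃` parts
  have hkey : 6 * (C₁ * C₂) * t ^ 2 / D ^ 4 < 8 * C₁ ^ 3 / (R : ℝ) ^ 12 := by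
    have e : (2 * C₁ / (R : ℝ) ^ 4) ^ 3 = 8 * C₁ ^ 3 / (R : ℝ) ^ 12 := by
      rw [div_pow]; ring
    have e' : 6 * (C₁ * C₂) * t ^ 2 / D ^ 4 = 2 * (3 * ((C₁ * t) * (C₂ * t / D ^ 4))) := by ring
    rw [← e, e']
    linarith
  have h6 : (0 : ℝ) < 6 * t ^ 2 / D ^ 4 := by positivity
  have h1 : C₁ * C₂ < 8 * C₁ ^ 3 / (R : ℝ) ^ 12 / (6 * t ^ 2 / D ^ 4) := by
    rw [lt_div_iff₀ h6]
    have e'' : C₁ * C₂ * (6 * t ^ 2 / D ^ 4) = 6 * (C₁ * C₂) * t ^ 2 / D ^ 4 := by ring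
    rw [e'']
    exact hkey
  have e3 : 8 * C₁ ^ 3 / (R : ℝ) ^ 12 / (6 * t ^ 2 / D ^ 4) = 4 / 3 * C₁ ^ 3 * κ ^ 8 * (s + 2 * σ) ^ 4 / (s * R) ^ 12 := by
    rw [hD, ht]
    field_simp
    ring
  rw [e3] at h1
  have hKK : 0 ≤ 4 / 3 * C₁ ^ 3 * κ ^ 8 * (s + 2 * σ) ^ 4 := by positivity
  exact h1.trans_le (div_le_div_of_nonneg_left hKK (pow_pos (by linarith) 12) (pow_le_pow_left₀ (by linarith) hR4 12))

/-- **`C₃` is priced, β-uniformly: `C₃ ≤ 8C₁³κ⁴(2σ)⁸/(δ'/4)¹²`.**  Let `a > 0`, `a → 0`; assume clause 1 of the registered package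
(`C₁ ≥ 0`, range `ℓ`) and its clause 5 (`C₂, C₃ ≥ 0`, `κ > 0`, `ε > 0`) for witnesses `f, g, h` in the ball of radius `σ ≥ 0` with
pairwise support separation `δ' > 0`, `δ' ≤ 2ℓ`, on collar-large reference tori (`2σ ≤ aβ·L₀β`, `δ' ≤ aβ·L₀β`).  Then
`C₃ ≤ 8C₁³κ⁴(2σ)⁸/(δ'/4)¹²` (`= 2¹¹·4¹²·C₁³κ⁴σ⁸/δ'¹²`). [folklore] -/
theorem C₃_le_of_clause5 (a : ℝ → ℝ) (ha : ∀ β, 0 < a β) (ha0 : Tendsto a atTop (𝓝 0)) {C₁ C₂ C₃ ℓ κ : ℝ}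
    (hC₁ : 0 ≤ C₁) (hC₂ : 0 ≤ C₂) (hC₃ : 0 ≤ C₃) (hκ : 0 < κ)
    (hE1 : ∃ β₁ : ℝ, ∀ β : ℝ, β₁ ≤ β → ∀ (c : Fin 4 → ℤ) (b : ℕ), (b : ℝ) * a β ≤ ℓ →
      ∀ (η η' : LGConfig 4 G) (x : Fin 4 → ℤ), 1 ≤ depth c b x →
        |kerE G r β c b η (dens G r x) - kerE G r β c b η' (dens G r x)| ≤ C₁ / (depth c b x : ℝ) ^ 4)
    {f g h : 𝓢(EuclideanSpace ℝ (Fin 4), ℝ)} {δ' σ ε : ℝ} (hε : 0 < ε) (hσ : 0 ≤ σ) (hδ' : 0 < δ') (hδ'ℓ : δ' ≤ 2 * ℓ)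
    (hfg : ∀ p q : EuclideanSpace ℝ (Fin 4), f p ≠ 0 → g q ≠ 0 → δ' ≤ ‖p - q‖)
    (hgh : ∀ p q : EuclideanSpace ℝ (Fin 4), g p ≠ 0 → h q ≠ 0 → δ' ≤ ‖p - q‖)
    (hfh : ∀ p q : EuclideanSpace ℝ (Fin 4), f p ≠ 0 → h q ≠ 0 → δ' ≤ ‖p - q‖)
    (hfσ : tsupport (f : EuclideanSpace ℝ (Fin 4) → ℝ) ⊆ Metric.closedBall 0 σ)
    (hgσ : tsupport (g : EuclideanSpace ℝ (Fin 4) → ℝ) ⊆ Metric.closedBall 0 σ)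
    (hhσ : tsupport (h : EuclideanSpace ℝ (Fin 4) → ℝ) ⊆ Metric.closedBall 0 σ) {β₅ : ℝ} {L₀ : ℝ → ℕ}
    (hL₀ : ∀ β : ℝ, β₅ ≤ β → 2 * σ ≤ a β * L₀ β ∧ δ' ≤ a β * L₀ β)
    (hfloor : ∀ β : ℝ, β₅ ≤ β →
      ε + ∑ x ∈ box 4 (L₀ β), ∑ y ∈ box 4 (L₀ β), ∑ z ∈ box 4 (L₀ β),
          |f (a β • siteToE x)| * |g (a β • siteToE y)| * |h (a β • siteToE z)| *
            (2 * ((C₁ * (a β / κ) ^ 4) * (C₂ * (a β / κ) ^ 4 / (1 + ‖siteToE (z - y)‖) ^ 4) +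
                  (C₁ * (a β / κ) ^ 4) * (C₂ * (a β / κ) ^ 4 / (1 + ‖siteToE (z - x)‖) ^ 4) +
                  (C₁ * (a β / κ) ^ 4) * (C₂ * (a β / κ) ^ 4 / (1 + ‖siteToE (y - x)‖) ^ 4) +
                  (C₁ * (a β / κ) ^ 4) * (C₁ * (a β / κ) ^ 4) * (C₁ * (a β / κ) ^ 4)) +
              C₃ * (a β / κ) ^ 4 /
                (1 + min (min ‖siteToE (y - x)‖ ‖siteToE (z - y)‖) ‖siteToE (z - x)‖) ^ 8) ≤
        |Q3 G r β (L₀ β) (a β) f g h|) :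
    C₃ ≤ 8 * C₁ ^ 3 * κ ^ 4 * (2 * σ) ^ 8 / (δ' / 4) ^ 12 := by
  obtain ⟨β₁, H1⟩ := hE1
  have hev : ∀ᶠ β in atTop, C₃ < 8 * C₁ ^ 3 * κ ^ 4 * (a β + 2 * σ) ^ 8 / (δ' / 4 - 3 * a β) ^ 12 := by
    have hsmall : ∀ᶠ β in atTop, a β < δ' / 4 / 3 := ha0.eventually (gt_mem_nhds (by positivity))
    filter_upwards [hsmall, eventually_ge_atTop β₁, eventually_ge_atTop β₅] with β hβs hβ1 hβ5
    have h3 : 3 * a β < δ' / 4 := by linarith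
    obtain ⟨hσL, hδL⟩ := hL₀ β hβ5
    exact C₃_lt_of_clause5_at G r β hC₁ hC₂ hC₃ hκ (ha β) (H1 β hβ1) hε hσ h3 hδ'ℓ hfg hgh hfh hfσ hgσ hhσ hσL hδL
      (hfloor β hβ5)
  have hlim : Tendsto (fun β => 8 * C₁ ^ 3 * κ ^ 4 * (a β + 2 * σ) ^ 8 / (δ' / 4 - 3 * a β) ^ 12) atTop
      (𝓝 (8 * C₁ ^ 3 * κ ^ 4 * (2 * σ) ^ 8 / (δ' / 4) ^ 12)) := by
    have hn : Tendsto (fun β => 8 * C₁ ^ 3 * κ ^ 4 * (a β + 2 * σ) ^ 8) atTop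
        (𝓝 (8 * C₁ ^ 3 * κ ^ 4 * (0 + 2 * σ) ^ 8)) := ((ha0.add tendsto_const_nhds).pow 8).const_mul _
    have hd : Tendsto (fun β => (δ' / 4 - 3 * a β) ^ 12) atTop (𝓝 ((δ' / 4 - 3 * 0) ^ 12)) :=
      (tendsto_const_nhds.sub (ha0.const_mul 3)).pow 12
    rw [zero_add] at hn
    rw [mul_zero, sub_zero] at hd
    exact hn.div hd (pow_ne_zero 12 (by positivity))
  exact ge_of_tendsto hlim (hev.mono fun β hβ => hβ.le)

/-- **`C₁C₂` is priced, β-uniformly: `C₁C₂ ≤ (4/3)C₁³κ⁸(2σ)⁴/(δ'/4)¹²`** (same hypotheses). [folklore] -/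
theorem C₁C₂_le_of_clause5 (a : ℝ → ℝ) (ha : ∀ β, 0 < a β) (ha0 : Tendsto a atTop (𝓝 0)) {C₁ C₂ C₃ ℓ κ : ℝ}
    (hC₁ : 0 ≤ C₁) (hC₂ : 0 ≤ C₂) (hC₃ : 0 ≤ C₃) (hκ : 0 < κ)
    (hE1 : ∃ β₁ : ℝ, ∀ β : ℝ, β₁ ≤ β → ∀ (c : Fin 4 → ℤ) (b : ℕ), (b : ℝ) * a β ≤ ℓ →
      ∀ (η η' : LGConfig 4 G) (x : Fin 4 → ℤ), 1 ≤ depth c b x →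
        |kerE G r β c b η (dens G r x) - kerE G r β c b η' (dens G r x)| ≤ C₁ / (depth c b x : ℝ) ^ 4)
    {f g h : 𝓢(EuclideanSpace ℝ (Fin 4), ℝ)} {δ' σ ε : ℝ} (hε : 0 < ε) (hσ : 0 ≤ σ) (hδ' : 0 < δ') (hδ'ℓ : δ' ≤ 2 * ℓ)
    (hfg : ∀ p q : EuclideanSpace ℝ (Fin 4), f p ≠ 0 → g q ≠ 0 → δ' ≤ ‖p - q‖)
    (hgh : ∀ p q : EuclideanSpace ℝ (Fin 4), g p ≠ 0 → h q ≠ 0 → δ' ≤ ‖p - q‖)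
    (hfh : ∀ p q : EuclideanSpace ℝ (Fin 4), f p ≠ 0 → h q ≠ 0 → δ' ≤ ‖p - q‖)
    (hfσ : tsupport (f : EuclideanSpace ℝ (Fin 4) → ℝ) ⊆ Metric.closedBall 0 σ)
    (hgσ : tsupport (g : EuclideanSpace ℝ (Fin 4) → ℝ) ⊆ Metric.closedBall 0 σ)
    (hhσ : tsupport (h : EuclideanSpace ℝ (Fin 4) → ℝ) ⊆ Metric.closedBall 0 σ) {β₅ : ℝ} {L₀ : ℝ → ℕ}
    (hL₀ : ∀ β : ℝ, β₅ ≤ β → 2 * σ ≤ a β * L₀ β ∧ δ' ≤ a β * L₀ β)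
    (hfloor : ∀ β : ℝ, β₅ ≤ β →
      ε + ∑ x ∈ box 4 (L₀ β), ∑ y ∈ box 4 (L₀ β), ∑ z ∈ box 4 (L₀ β),
          |f (a β • siteToE x)| * |g (a β • siteToE y)| * |h (a β • siteToE z)| *
            (2 * ((C₁ * (a β / κ) ^ 4) * (C₂ * (a β / κ) ^ 4 / (1 + ‖siteToE (z - y)‖) ^ 4) +
                  (C₁ * (a β / κ) ^ 4) * (C₂ * (a β / κ) ^ 4 / (1 + ‖siteToE (z - x)‖) ^ 4) +
                  (C₁ * (a β / κ) ^ 4) * (C₂ * (a β / κ) ^ 4 / (1 + ‖siteToE (y - x)‖) ^ 4) +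
                  (C₁ * (a β / κ) ^ 4) * (C₁ * (a β / κ) ^ 4) * (C₁ * (a β / κ) ^ 4)) +
              C₃ * (a β / κ) ^ 4 /
                (1 + min (min ‖siteToE (y - x)‖ ‖siteToE (z - y)‖) ‖siteToE (z - x)‖) ^ 8) ≤
        |Q3 G r β (L₀ β) (a β) f g h|) :
    C₁ * C₂ ≤ 4 / 3 * C₁ ^ 3 * κ ^ 8 * (2 * σ) ^ 4 / (δ' / 4) ^ 12 := by
  obtain ⟨β₁, H1⟩ := hE1
  have hev : ∀ᶠ β in atTop, C₁ * C₂ < 4 / 3 * C₁ ^ 3 * κ ^ 8 * (a β + 2 * σ) ^ 4 / (δ' / 4 - 3 * a β) ^ 12 := by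
    have hsmall : ∀ᶠ β in atTop, a β < δ' / 4 / 3 := ha0.eventually (gt_mem_nhds (by positivity))
    filter_upwards [hsmall, eventually_ge_atTop β₁, eventually_ge_atTop β₅] with β hβs hβ1 hβ5
    have h3 : 3 * a β < δ' / 4 := by linarith
    obtain ⟨hσL, hδL⟩ := hL₀ β hβ5
    exact C₁C₂_lt_of_clause5_at G r β hC₁ hC₂ hC₃ hκ (ha β) (H1 β hβ1) hε hσ h3 hδ'ℓ hfg hgh hfh hfσ hgσ hhσ hσL hδL
      (hfloor β hβ5)
  have hlim : Tendsto (fun β => 4 / 3 * C₁ ^ 3 * κ ^ 8 * (a β + 2 * σ) ^ 4 / (δ' / 4 - 3 * a β) ^ 12) atTop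
      (𝓝 (4 / 3 * C₁ ^ 3 * κ ^ 8 * (2 * σ) ^ 4 / (δ' / 4) ^ 12)) := by
    have hn : Tendsto (fun β => 4 / 3 * C₁ ^ 3 * κ ^ 8 * (a β + 2 * σ) ^ 4) atTop
        (𝓝 (4 / 3 * C₁ ^ 3 * κ ^ 8 * (0 + 2 * σ) ^ 4)) := ((ha0.add tendsto_const_nhds).pow 4).const_mul _
    have hd : Tendsto (fun β => (δ' / 4 - 3 * a β) ^ 12) atTop (𝓝 ((δ' / 4 - 3 * 0) ^ 12)) :=
      (tendsto_const_nhds.sub (ha0.const_mul 3)).pow 12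
    rw [zero_add] at hn
    rw [mul_zero, sub_zero] at hd
    exact hn.div hd (pow_ne_zero 12 (by positivity))
  exact ge_of_tendsto hlim (hev.mono fun β hβ => hβ.le)

/-- Reading for `C₁ > 0`: **`C₂ ≤ (4/3)C₁²κ⁸(2σ)⁴/(δ'/4)¹²`** from the three-point window alone. [folklore] -/
theorem C₂_le_of_C₁C₂_le {C₁ C₂ K : ℝ} (hC₁ : 0 < C₁) (h : C₁ * C₂ ≤ 4 / 3 * C₁ ^ 3 * K) :
    C₂ ≤ 4 / 3 * C₁ ^ 2 * K := by
  have e : 4 / 3 * C₁ ^ 3 * K = C₁ * (4 / 3 * C₁ ^ 2 * K) := by ring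
  rw [e] at h
  exact le_of_mul_le_mul_left h hC₁

end Package

end Summit.QuantumFields.YangMills.Cruxes.NT.CeilingPrice

end
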